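/-
Copyright (c) 2026 The H21 project. Released under Apache 2.0 license.
-/
import Mathlib.Data.EReal.Basic
import Summits.RiemannHypothesis.RiemannHypothesis.Theorems.PfPersistenceIntruderCapacitanceMono
import HarnessLib

/-!
# PF-persistence THEORY 3 (gen 10) — the capacitance law WITHOUT WITNESSES and WITHOUT DIMENSION:
# `q − φ²` is indefinite iff the Dirichlet functional `2φ − q` exceeds `1`; the capacitance is its
# supremum in `[0, ∞]`, monotone under EVERY linear compression, detected on any dense subspace
# (publication cell `pub-rhpf`, theory seat 3)

Framing (page 1 of every `pub-rhpf` file): **mechanism/rigidity campaign — nothing here is a claim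
about RH.** Everything below is PROVED abstract (linear) algebra — no definitions, no statement
about `ζ` or any control family; words of record:
`run/shared/lean/pub/pub-rhpf/pub-rhpf-theory-3/THEORY-INTRUDER.md` §15.

WHY.  The gen-3…9 laws (`negative_iff_secular_gt_one`, `secular_law`, `secular_mono`, …) are stated
through WITNESSES `B z = v` (solvable in finite dimension under the certified premise `B > 0`), and
gen 9's monotonicity is tied to the `N`-ladder.  The VARIATIONAL form needs neither.  On a bare real
vector space `V` with 'remainder' `q : V → ℝ` and 'drivers' `φᵢ : V →ₗ[ℝ] ℝ`:
* §1 LAW (hypothesis-free): `q − φ²` takes a negative value iff `∃ c x, c² < 2cφ(x) − q(x)`; for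
  `q ≥ 0` homogeneous of degree two (`q = ⟪B·,·⟫`) take `c = 1`: **indefinite iff `1 < 𝔰`,
  `𝔰 := supₓ (2φ(x) − q(x)) ∈ [0, ∞]`** (an extended real: no inverse, no witness, no dimension, no
  topology); `q ≥ φ²` iff `𝔰 ≤ 1`; a bound `S` of the Dirichlet functional gives `φ² ≤ S·q`.  With a
  witness, `𝔰 = ⟪v, z⟫` (gen 9 `secular_isGreatest`): the TH3-N2 secular law freed of its premise.
* §2 MONOTONICITY under ANY linear `J : V → V'` with `q = q' ∘ J`, `φ = φ' ∘ J` (a Galerkin rung in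
  a bigger rung, a rung in a continuum window, the window `[−a,a]` in `[−a',a']` by extension by
  zero — all this shape): `𝔰 ≤ 𝔰'`; indefiniteness and every `k`-dimensional negative subspace pass
  UP (`J` neither injective nor isometric); along any system of spaces indexed by a preorder the
  indefinite parameters form an UPPER SET and `𝔰` is monotone — 'once negative, always negative'.
* §3 DENSITY (continuous `q`, `φ`): indefiniteness is detected on any dense subset, bounds of the
  Dirichlet functional on a dense subset are global; for subspaces with dense union the big space
  is indefinite iff SOME rung is.
* §4 SEVERAL DRIVERS `q − ∑φᵢ²`: indefinite iff `∃ c x, |c|² < 2∑cᵢφᵢ(x) − q(x)` (hypothesis-free);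
  a `k`-dimensional negative subspace gives a `k`-dimensional COEFFICIENT subspace on which the
  trial functional beats `|c|²` (`q ≥ 0`; so `k ≤ #ι`) — the witness-free half of
  `n₋ = #{μ(M) > 1}`; the other half is `secular_law` (witness form, in tree).
* §5 DICTIONARY to `S : OffLineSplitN T ι`: the law for `⟪Tx,x⟫ < 0` hypothesis-free; trial values
  `≤ cᵀMc` when witnesses exist; `2⟪v,x⟫ − ⟪Bx,x⟫ ≤ ‖v‖²/β` under `β`-coercivity in ANY dimension;
  index and capacitance monotone for nested splits, premise-free.
NOT proved: maximisers outside finite dimension; the converse of §4 at level `k ≥ 2` without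
witnesses; any concrete continuum window space; anything in DATA.  Don't-look sentence (RULING A24
k4): every statement holds for any `q, φ` — DH, Epstein, planted controls and `ζ` alike.

## References
* R. T. Rockafellar, *Convex Analysis* (1970), §12 (conjugate of a quadratic). [Rockafellar1970]
* G. H. Golub, C. F. Van Loan, *Matrix Computations*, 4th ed. (2013), §11.3.1. [GolubVanLoan2013]
* M. Reed, B. Simon, *Methods of Modern Mathematical Physics* IV, §XIII.1 (min–max over a dense
  core). [ReedSimon1972]
* R. A. Horn, C. R. Johnson, *Matrix Analysis*, 2nd ed. (2013), Thm 4.3.28, Cor. 7.7.4.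
  [HornJohnson2013]
-/

open scoped InnerProductSpace BigOperators
open Filter Topology

set_option linter.dupNamespace false

namespace Summit.RiemannHypothesis.RiemannHypothesis.Theorems.PfPersistenceIntruderCapacitanceVariational

open Summit.RiemannHypothesis.RiemannHypothesis.Theorems.PfPersistenceIntruderShadowMulti (OffLineSplitN)
open Summit.RiemannHypothesis.RiemannHypothesis.Theorems.PfPersistenceIntruderCapacitanceMono
  (trial_le_secular sum_sum_mul_inner_eq inner_apply_self_nested)

section VectorSpace

variable {V : Type*} [AddCommGroup V] [Module ℝ V] {V' : Type*} [AddCommGroup V'] [Module ℝ V']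

/-! ## 1. The law, witness-free -/

/-- **The rank-one law, hypothesis-free.**  For ANY `q : V → ℝ` and linear `φ`, the downdate
`q − φ²` takes a negative value iff a scaled Dirichlet trial value beats its threshold:
`(∃ x, q x < (φ x)²) ↔ ∃ c x, c² < 2cφ(x) − q(x)` (→ `c = φ x`; ← `(φ x − c)² ≥ 0`).
[cite: Rockafellar1970, §12] -/
theorem indefinite_iff_exists_trial (q : V → ℝ) (φ : V →ₗ[ℝ] ℝ) :
    (∃ x, q x < (φ x) ^ 2) ↔ ∃ (c : ℝ) (x : V), c ^ 2 < 2 * c * φ x - q x := by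
  constructor
  · rintro ⟨x, hx⟩
    exact ⟨φ x, x, by nlinarith [hx]⟩
  · rintro ⟨c, x, h⟩
    exact ⟨x, by nlinarith [sq_nonneg (φ x - c), h]⟩

/-- **The law at threshold one** (`q ≥ 0`, homogeneous of degree two — e.g. `q = ⟪B·,·⟫`, `B ≥ 0`):
`(∃ x, q x < (φ x)²) ↔ ∃ x, 1 < 2φ(x) − q(x)` (rescale by `c⁻¹`).  No witness, no dimension, no
topology. [cite: Rockafellar1970, §12; GolubVanLoan2013, §11.3.1] -/
theorem indefinite_iff_exists_trial_gt_one (q : V → ℝ)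
    (hq2 : ∀ (t : ℝ) (x : V), q (t • x) = t ^ 2 * q x) (hq0 : ∀ x, 0 ≤ q x) (φ : V →ₗ[ℝ] ℝ) :
    (∃ x, q x < (φ x) ^ 2) ↔ ∃ x, 1 < 2 * φ x - q x := by
  rw [indefinite_iff_exists_trial]
  constructor
  · rintro ⟨c, x, h⟩
    have hc : c ≠ 0 := by rintro rfl; nlinarith [h, hq0 x]
    refine ⟨c⁻¹ • x, ?_⟩
    have hs : 2 * φ (c⁻¹ • x) - q (c⁻¹ • x) = (2 * c * φ x - q x) / c ^ 2 := by
      rw [map_smul, hq2, smul_eq_mul]; field_simp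
    rwa [hs, lt_div_iff₀ (sq_pos_iff.mpr hc), one_mul]
  · rintro ⟨x, h⟩
    exact ⟨1, x, by linarith⟩

/-- **Nonnegative iff the capacitance is at most one**:
`(∀ x, (φ x)² ≤ q x) ↔ ∀ x, 2φ(x) − q(x) ≤ 1`. [cite: Rockafellar1970, §12] -/
theorem nonneg_iff_forall_trial_le_one (q : V → ℝ)
    (hq2 : ∀ (t : ℝ) (x : V), q (t • x) = t ^ 2 * q x) (hq0 : ∀ x, 0 ≤ q x) (φ : V →ₗ[ℝ] ℝ) :
    (∀ x, (φ x) ^ 2 ≤ q x) ↔ ∀ x, 2 * φ x - q x ≤ 1 := by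
  rw [← not_iff_not]; push Not; exact indefinite_iff_exists_trial_gt_one q hq2 hq0 φ

/-- **Witness-free Cauchy–Schwarz**: ANY bound `S` of the Dirichlet functional controls the driver
by the remainder, `(∀ y, 2φ(y) − q(y) ≤ S) ⇒ (φ x)² ≤ S·q(x)` (discriminant in the scale); with a
witness `S = ⟪v,z⟫` this is gen 9's `inner_sq_le_secular_mul`. [folklore] -/
theorem sq_le_bound_mul (q : V → ℝ) (hq2 : ∀ (t : ℝ) (x : V), q (t • x) = t ^ 2 * q x)
    (φ : V →ₗ[ℝ] ℝ) {S : ℝ} (hS : ∀ y, 2 * φ y - q y ≤ S) (x : V) : (φ x) ^ 2 ≤ S * q x := by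
  have hq : ∀ t : ℝ, 0 ≤ q x * (t * t) + (-(2 * φ x)) * t + S := fun t => by
    have h := hS (t • x); rw [map_smul, hq2, smul_eq_mul] at h; nlinarith [h]
  have hd := discrim_le_zero hq
  rw [discrim] at hd
  nlinarith [hd]

/-- **THE CAPACITANCE as an extended real**: `𝔰 := ⨆ₓ (2φ(x) − q(x)) ∈ EReal` always exists (it
is `≥ 0` by `x = 0` and may be `⊤`), and the law reads `indefinite ↔ 1 < 𝔰`.
[cite: Rockafellar1970, §12] -/
theorem indefinite_iff_one_lt_iSup (q : V → ℝ)
    (hq2 : ∀ (t : ℝ) (x : V), q (t • x) = t ^ 2 * q x) (hq0 : ∀ x, 0 ≤ q x) (φ : V →ₗ[ℝ] ℝ) :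
    (∃ x, q x < (φ x) ^ 2) ↔ (1 : EReal) < ⨆ x : V, ((2 * φ x - q x : ℝ) : EReal) := by
  rw [indefinite_iff_exists_trial_gt_one q hq2 hq0 φ, lt_iSup_iff]
  exact ⟨fun ⟨x, hx⟩ => ⟨x, by exact_mod_cast hx⟩, fun ⟨x, hx⟩ => ⟨x, by exact_mod_cast hx⟩⟩

/-! ## 2. Monotonicity under every linear compression; persistence as an upper set -/

section Mono

variable (q : V → ℝ) (q' : V' → ℝ) (φ : V →ₗ[ℝ] ℝ) (φ' : V' →ₗ[ℝ] ℝ) (J : V →ₗ[ℝ] V')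

/-- **The capacitance is monotone under ANY linear map** `J` with `q = q' ∘ J`, `φ = φ' ∘ J`:
`⨆ (2φ − q) ≤ ⨆ (2φ' − q')` in `EReal` (every trial value below is one above; `J` need be neither
injective nor isometric). [cite: HornJohnson2013, Thm 4.3.28] -/
theorem iSup_trial_mono (hq : ∀ x, q x = q' (J x)) (hφ : ∀ x, φ x = φ' (J x)) :
    ⨆ x : V, ((2 * φ x - q x : ℝ) : EReal) ≤ ⨆ y : V', ((2 * φ' y - q' y : ℝ) : EReal) :=
  iSup_le fun x => by
    rw [hq, hφ]
    exact le_iSup (fun y : V' => ((2 * φ' y - q' y : ℝ) : EReal)) (J x)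

/-- **Indefiniteness passes UP every compression** (hypothesis-free).
[cite: HornJohnson2013, Thm 4.3.28] -/
theorem indefinite_mono (hq : ∀ x, q x = q' (J x)) (hφ : ∀ x, φ x = φ' (J x))
    (h : ∃ x, q x < (φ x) ^ 2) : ∃ y, q' y < (φ' y) ^ 2 := by
  obtain ⟨x, hx⟩ := h
  exact ⟨J x, by rw [← hq, ← hφ]; exact hx⟩

/-- **Negative subspaces pass UP every compression, dimension preserved**: for `f = f' ∘ J`,
`0 ≤ f' 0`, a `k`-dimensional subspace on which `f < 0` off `0` is mapped by `J` INJECTIVELY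
onto one on which `f' < 0` (else `f x = f' 0 ≥ 0`). [cite: HornJohnson2013, Thm 4.3.28] -/
theorem negSubspace_map (f : V → ℝ) (f' : V' → ℝ) (hf : ∀ x, f x = f' (J x)) (h0 : 0 ≤ f' 0)
    {k : ℕ} (h : ∃ U : Submodule ℝ V, Module.finrank ℝ U = k ∧ ∀ x ∈ U, x ≠ 0 → f x < 0) :
    ∃ U' : Submodule ℝ V', Module.finrank ℝ U' = k ∧ ∀ y ∈ U', y ≠ 0 → f' y < 0 := by
  obtain ⟨U, hU, hneg⟩ := h
  have hG : ∀ x : U, (J ∘ₗ U.subtype) x = J (x : V) := fun x => rfl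
  have hinj : Function.Injective (J ∘ₗ U.subtype) := by
    rw [← LinearMap.ker_eq_bot, LinearMap.ker_eq_bot']
    intro x hx; by_contra hx0
    have h1 := hneg x x.2 fun h => hx0 (Subtype.ext h)
    rw [hf, ← hG, hx] at h1; exact absurd h1 (not_lt.mpr h0)
  refine ⟨LinearMap.range (J ∘ₗ U.subtype), by rw [LinearMap.finrank_range_of_inj hinj, hU], ?_⟩
  rintro _ ⟨x, rfl⟩ hy0
  have hx0 : (x : V) ≠ 0 := by intro h; apply hy0; rw [hG, h, map_zero]
  have h1 := hneg x x.2 hx0; rwa [hf] at h1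

end Mono

section System

variable {α : Type*} [Preorder α] (W : α → Type*) [∀ a, AddCommGroup (W a)] [∀ a, Module ℝ (W a)]
  (q : ∀ a, W a → ℝ) (φ : ∀ a, W a →ₗ[ℝ] ℝ) (J : ∀ ⦃a b : α⦄, a ≤ b → W a →ₗ[ℝ] W b)

/-- **PERSISTENCE: the indefinite parameters form an UPPER SET.**  For any system of spaces `W a`
indexed by a preorder (windows by half-width `a`, Galerkin rungs by `N`, both at once, …) with
linear transition maps along `a ≤ b` preserving remainder and driver, `q_a − φ_a²` indefinite
forces `q_b − φ_b²` indefinite for every `b ≥ a`: the first indefinite parameter is a point of no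
return (WHICH parameter, for a given family, is DATA). [cite: HornJohnson2013, Thm 4.3.28] -/
theorem isUpperSet_indefinite (hq : ∀ ⦃a b : α⦄ (h : a ≤ b) (x : W a), q a x = q b (J h x))
    (hφ : ∀ ⦃a b : α⦄ (h : a ≤ b) (x : W a), φ a x = φ b (J h x)) :
    IsUpperSet {a : α | ∃ x : W a, q a x < (φ a x) ^ 2} :=
  fun _ _ hab h => indefinite_mono _ _ _ _ (J hab) (hq hab) (hφ hab) h

/-- Along such a system the extended-real capacitance `a ↦ ⨆ₓ (2φ_a(x) − q_a(x))` is MONOTONE.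
[cite: HornJohnson2013, Cor. 7.7.4] -/
theorem monotone_iSup_trial (hq : ∀ ⦃a b : α⦄ (h : a ≤ b) (x : W a), q a x = q b (J h x))
    (hφ : ∀ ⦃a b : α⦄ (h : a ≤ b) (x : W a), φ a x = φ b (J h x)) :
    Monotone fun a => ⨆ x : W a, ((2 * φ a x - q a x : ℝ) : EReal) :=
  fun _ _ hab => iSup_trial_mono _ _ _ _ (J hab) (hq hab) (hφ hab)

end System

/-! ## 3. Density: the law is detected on any dense subspace (e.g. a Galerkin ladder's union) -/

section Density

variable [TopologicalSpace V] (q : V → ℝ) (φ : V →ₗ[ℝ] ℝ)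

/-- **Indefiniteness is detected on every dense subset** (continuous `q`, `φ`; the negativity set
is open). [cite: ReedSimon1972, Thm XIII.2] -/
theorem indefinite_iff_exists_mem_dense (hqc : Continuous q) (hφc : Continuous φ) {D : Set V}
    (hD : Dense D) : (∃ x, q x < (φ x) ^ 2) ↔ ∃ x ∈ D, q x < (φ x) ^ 2 := by
  refine ⟨fun ⟨x, hx⟩ => ?_, fun ⟨x, _, hx⟩ => ⟨x, hx⟩⟩
  obtain ⟨y, hyD, hy⟩ := hD.exists_mem_open (isOpen_lt hqc (hφc.pow 2)) ⟨x, hx⟩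
  exact ⟨y, hyD, hy⟩

/-- **Every bound of the Dirichlet functional on a dense subset is global** — the capacitance of
the big space is the supremum over the dense subset. [cite: ReedSimon1972, Thm XIII.2] -/
theorem trial_le_of_dense (hqc : Continuous q) (hφc : Continuous φ) {D : Set V} (hD : Dense D)
    {M : ℝ} (hM : ∀ y ∈ D, 2 * φ y - q y ≤ M) (x : V) : 2 * φ x - q x ≤ M := by
  have hc : IsClosed {y : V | 2 * φ y - q y ≤ M} :=
    isClosed_le ((continuous_const.mul hφc).sub hqc) continuous_const
  have hsub : closure D ⊆ {y : V | 2 * φ y - q y ≤ M} := hc.closure_subset_iff.mpr hM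
  exact hsub (by rw [hD.closure_eq]; exact Set.mem_univ x)

/-- **Ladder form**: if the subspaces `W N` have dense union, the big space is indefinite iff SOME
rung is — 'the continuum window is indefinite iff some Galerkin rung is', for any concrete ladder
dense in a topology making `q`, `φ` continuous. [cite: ReedSimon1972, Thm XIII.2] -/
theorem indefinite_iff_exists_rung (hqc : Continuous q) (hφc : Continuous φ) {κ : Type*}
    (W : κ → Submodule ℝ V) (hW : Dense (⋃ N, (W N : Set V))) :
    (∃ x, q x < (φ x) ^ 2) ↔ ∃ N, ∃ x ∈ W N, q x < (φ x) ^ 2 := by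
  rw [indefinite_iff_exists_mem_dense q φ hqc hφc hW]
  simp only [Set.mem_iUnion]
  exact ⟨fun ⟨x, ⟨N, hN⟩, h⟩ => ⟨N, x, hN, h⟩, fun ⟨N, x, hN, h⟩ => ⟨x, ⟨N, hN⟩, h⟩⟩

end Density

/-! ## 4. Several drivers: the witness-free half of `n₋ = #{μ(M) > 1}` -/

section Multi

variable {ι : Type*} [Fintype ι] (q : V → ℝ) (φ : ι → V →ₗ[ℝ] ℝ)

/-- **Multi-driver law, hypothesis-free**: `q − ∑ᵢφᵢ²` takes a negative value iff for some
coefficient vector `c` and trial vector `x`, `|c|² < 2∑cᵢφᵢ(x) − q(x)` (→ `cᵢ = φᵢ x`;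
← `∑(φᵢx − cᵢ)² ≥ 0`). [cite: Rockafellar1970, §12; HornJohnson2013, Cor. 7.7.4] -/
theorem indefiniteN_iff_exists_trial :
    (∃ x, q x < ∑ i, (φ i x) ^ 2) ↔
      ∃ (c : ι → ℝ) (x : V), ∑ i, c i ^ 2 < 2 * ∑ i, c i * φ i x - q x := by
  have key : ∀ (c : ι → ℝ) (x : V), ∑ i, (φ i x - c i) ^ 2 =
      ∑ i, (φ i x) ^ 2 - 2 * ∑ i, c i * φ i x + ∑ i, c i ^ 2 := fun c x => by
    have h : ∀ i ∈ Finset.univ, (φ i x - c i) ^ 2 = (φ i x) ^ 2 - 2 * (c i * φ i x) + c i ^ 2 :=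
      fun i _ => by ring
    rw [Finset.sum_congr rfl h, Finset.sum_add_distrib, Finset.sum_sub_distrib, Finset.mul_sum]
  constructor
  · rintro ⟨x, hx⟩
    refine ⟨fun i => φ i x, x, ?_⟩
    show ∑ i, (φ i x) ^ 2 < 2 * ∑ i, φ i x * φ i x - q x
    have h2 : ∑ i, φ i x * φ i x = ∑ i, (φ i x) ^ 2 := Finset.sum_congr rfl fun i _ => by ring
    rw [h2]; linarith
  · rintro ⟨c, x, h⟩
    have h0 : 0 ≤ ∑ i, (φ i x - c i) ^ 2 := Finset.sum_nonneg fun i _ => sq_nonneg _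
    exact ⟨x, by rw [key] at h0; linarith⟩

/-- **A `k`-dimensional negative subspace yields a `k`-dimensional super-critical COEFFICIENT
subspace** (`q ≥ 0`): the driver map `x ↦ (φᵢ x)ᵢ` is injective on it (so `k ≤ #ι`, cf.
`FiniteRankDowndate`), and every nonzero `c` in the image has a trial vector with
`|c|² < 2∑cᵢφᵢ(x) − q(x)`; with witnesses (§5, sup `= cᵀMc`) this is `n₋ ≥ k ⇒ #{μ(M) > 1} ≥ k`
without solving anything. [cite: HornJohnson2013, Cor. 7.7.4; Haynsworth1968] -/
theorem exists_coeffSubspace_of_negSubspace (hq0 : ∀ x, 0 ≤ q x) {k : ℕ}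
    (h : ∃ U : Submodule ℝ V, Module.finrank ℝ U = k ∧
      ∀ x ∈ U, x ≠ 0 → q x < ∑ i, (φ i x) ^ 2) :
    ∃ C : Submodule ℝ (ι → ℝ), Module.finrank ℝ C = k ∧
      ∀ c ∈ C, c ≠ 0 → ∃ x : V, ∑ i, c i ^ 2 < 2 * ∑ i, c i * φ i x - q x := by
  obtain ⟨U, hU, hneg⟩ := h
  have hG : ∀ (x : U) (i : ι), (LinearMap.pi φ ∘ₗ U.subtype) x i = φ i (x : V) := fun x i => rfl
  have hinj : Function.Injective (LinearMap.pi φ ∘ₗ U.subtype) := by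
    rw [← LinearMap.ker_eq_bot, LinearMap.ker_eq_bot']
    intro x hx; by_contra hx0
    have h1 := hneg x x.2 fun h => hx0 (Subtype.ext h)
    have h2 : ∑ i, (φ i (x : V)) ^ 2 = 0 := Finset.sum_eq_zero fun i _ => by rw [← hG, hx]; simp
    linarith [hq0 (x : V)]
  refine ⟨LinearMap.range (LinearMap.pi φ ∘ₗ U.subtype),
    by rw [LinearMap.finrank_range_of_inj hinj, hU], ?_⟩
  rintro _ ⟨x, rfl⟩ hc0
  have hx0 : (x : V) ≠ 0 := by intro h; apply hc0; ext i; rw [hG, h, map_zero]; rfl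
  refine ⟨(x : V), ?_⟩
  have h1 := hneg x x.2 hx0
  have h2 : ∑ i, φ i (x : V) * φ i (x : V) = ∑ i, (φ i (x : V)) ^ 2 :=
    Finset.sum_congr rfl fun i _ => by ring
  simp only [hG]; rw [h2]; linarith

/-- Multi-driver negative subspaces pass UP every compression (`0 ≤ q' 0`).
[cite: HornJohnson2013, Thm 4.3.28] -/
theorem negSubspaceN_mono (q' : V' → ℝ) (φ' : ι → V' →ₗ[ℝ] ℝ) (J : V →ₗ[ℝ] V')
    (hq : ∀ x, q x = q' (J x)) (hφ : ∀ i x, φ i x = φ' i (J x)) (h0 : 0 ≤ q' 0) {k : ℕ}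
    (h : ∃ U : Submodule ℝ V, Module.finrank ℝ U = k ∧
      ∀ x ∈ U, x ≠ 0 → q x < ∑ i, (φ i x) ^ 2) :
    ∃ U' : Submodule ℝ V', Module.finrank ℝ U' = k ∧
      ∀ y ∈ U', y ≠ 0 → q' y < ∑ i, (φ' i y) ^ 2 := by
  obtain ⟨U, hU, hn⟩ := h
  obtain ⟨U', hU', hn'⟩ := negSubspace_map J (fun x => q x - ∑ i, (φ i x) ^ 2)
    (fun y => q' y - ∑ i, (φ' i y) ^ 2) (fun x => by simp only [hq, hφ]) (by simpa using h0)
    ⟨U, hU, fun x hx hx0 => by linarith [hn x hx hx0]⟩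
  exact ⟨U', hU', fun y hy hy0 => by linarith [hn' y hy hy0]⟩

end Multi

end VectorSpace

/-! ## 5. Dictionary to the cell's windows `T = B − ∑ᵢ |vᵢ⟩⟨vᵢ|` -/

section InnerProduct

variable {E : Type*} [NormedAddCommGroup E] [InnerProductSpace ℝ E] {E' : Type*}
  [NormedAddCommGroup E'] [InnerProductSpace ℝ E']

/-- `x ↦ ⟪B x, x⟫` is homogeneous of degree two (hypothesis `hq2` of §1). [folklore] -/
theorem inner_apply_smul_self (B : E →ₗ[ℝ] E) (t : ℝ) (x : E) :
    ⟪B (t • x), t • x⟫_ℝ = t ^ 2 * ⟪B x, x⟫_ℝ := by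
  rw [map_smul, real_inner_smul_left, real_inner_smul_right]; ring

variable {ι : Type*} [Fintype ι] {T : E →ₗ[ℝ] E} {T' : E' →ₗ[ℝ] E'}

/-- **The window law, hypothesis-free**: for a split `T = B − ∑|vᵢ⟩⟨vᵢ|`, `⟪T x, x⟫ < 0` for some
`x` iff `|c|² < 2∑cᵢ⟪vᵢ,x⟫ − ⟪Bx,x⟫` for some `c, x` — no witness, no finite dimension, no
positive definiteness (only the split identity). [cite: Rockafellar1970, §12] -/
theorem negative_iff_exists_trial (S : OffLineSplitN T ι) :
    (∃ x, ⟪T x, x⟫_ℝ < 0) ↔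
      ∃ (c : ι → ℝ) (x : E), ∑ i, c i ^ 2 < 2 * ∑ i, c i * ⟪S.v i, x⟫_ℝ - ⟪S.B x, x⟫_ℝ := by
  have h := indefiniteN_iff_exists_trial (fun x => ⟪S.B x, x⟫_ℝ) (fun i => innerₛₗ ℝ (S.v i))
  simp only [innerₛₗ_apply_apply] at h
  rw [← h]; simp only [S.inner_apply_self, sub_neg]

/-- **Witness-free `n₋ ≥ k ⇒` a `k`-dimensional super-critical coefficient subspace**, for a split
window. [cite: HornJohnson2013, Cor. 7.7.4] -/
theorem exists_coeffSubspace_of_negSubspace_split (S : OffLineSplitN T ι) {k : ℕ}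
    (h : ∃ U : Submodule ℝ E, Module.finrank ℝ U = k ∧ ∀ x ∈ U, x ≠ 0 → ⟪T x, x⟫_ℝ < 0) :
    ∃ C : Submodule ℝ (ι → ℝ), Module.finrank ℝ C = k ∧
      ∀ c ∈ C, c ≠ 0 → ∃ x : E, ∑ i, c i ^ 2 < 2 * ∑ i, c i * ⟪S.v i, x⟫_ℝ - ⟪S.B x, x⟫_ℝ := by
  obtain ⟨U, hU, hn⟩ := h
  have h' := exists_coeffSubspace_of_negSubspace (fun x => ⟪S.B x, x⟫_ℝ)
    (fun i => innerₛₗ ℝ (S.v i)) S.B_nonneg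
    ⟨U, hU, fun x hx hx0 => by
      have := hn x hx hx0; rw [S.inner_apply_self] at this
      simpa only [innerₛₗ_apply_apply, sub_neg] using this⟩
  simpa only [innerₛₗ_apply_apply] using h'

/-- **Agreement with the witness form**: with witnesses `B zᵢ = vᵢ` every trial value is bounded by
the capacitance form, `2∑cᵢ⟪vᵢ,x⟫ − ⟪Bx,x⟫ ≤ cᵀMc = ∑ᵢⱼ cᵢcⱼ⟪vᵢ,zⱼ⟫` (equality at `x = ∑cⱼzⱼ`):
§4's super-critical `c` are those with `cᵀMc > |c|²`, i.e. `secular_law`.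
[cite: GolubVanLoan2013, §11.3.1] -/
theorem trialN_le_capacitanceForm (S : OffLineSplitN T ι) {z : ι → E}
    (hz : ∀ i, S.B (z i) = S.v i) (c : ι → ℝ) (x : E) :
    2 * ∑ i, c i * ⟪S.v i, x⟫_ℝ - ⟪S.B x, x⟫_ℝ ≤ ∑ i, ∑ j, c i * c j * ⟪S.v i, z j⟫_ℝ := by
  have hzc : S.B (∑ j, c j • z j) = ∑ i, c i • S.v i := by
    rw [map_sum]; exact Finset.sum_congr rfl fun i _ => by rw [map_smul, hz i]
  have h := trial_le_secular S.B S.B_symm S.B_nonneg hzc x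
  have h2 : ⟪∑ i, c i • S.v i, x⟫_ℝ = ∑ i, c i * ⟪S.v i, x⟫_ℝ := by
    rw [sum_inner]; exact Finset.sum_congr rfl fun i _ => by rw [real_inner_smul_left]
  rwa [sum_sum_mul_inner_eq, ← h2]

/-- **The capacitance is finite under coercivity, in ANY dimension**: `β⟪y,y⟫ ≤ ⟪By,y⟫`, `β > 0`
give `2⟪v,x⟫ − ⟪Bx,x⟫ ≤ ‖v‖²/β` for every `x` (no witness, no completeness): `𝔰 ∈ [0, ‖v‖²/β]`.
[folklore] -/
theorem trial_le_norm_sq_div (B : E →ₗ[ℝ] E) {β : ℝ} (hβ : 0 < β)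
    (hco : ∀ y : E, β * ⟪y, y⟫_ℝ ≤ ⟪B y, y⟫_ℝ) (v x : E) :
    2 * ⟪v, x⟫_ℝ - ⟪B x, x⟫_ℝ ≤ ‖v‖ ^ 2 / β := by
  have h1 : ⟪v, x⟫_ℝ ≤ ‖v‖ * ‖x‖ := real_inner_le_norm _ _
  have h2 : β * ‖x‖ ^ 2 ≤ ⟪B x, x⟫_ℝ := by rw [← real_inner_self_eq_norm_sq]; exact hco x
  rw [le_div_iff₀ hβ]
  have h3 : 2 * ⟪v, x⟫_ℝ * β ≤ 2 * (‖v‖ * ‖x‖) * β := by nlinarith [h1, hβ]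
  have h4 : β * (β * ‖x‖ ^ 2) ≤ β * ⟪B x, x⟫_ℝ := mul_le_mul_of_nonneg_left h2 hβ.le
  nlinarith [sq_nonneg (‖v‖ - β * ‖x‖), h3, h4]

/-- **Abstract index monotonicity for NESTED splits** (compression `⟪Bx,x⟫ = ⟪B'Jx,Jx⟫`, pullback
`⟪vᵢ,x⟫ = ⟪v'ᵢ,Jx⟫`): every `k`-dimensional `T`-negative subspace is carried by `J` to a
`k`-dimensional `T'`-negative one — the coordinate-free `PfPersistenceIntruderIndexMono` (there:
principal submatrices of the even block), any dimension, no premise.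
[cite: HornJohnson2013, Thm 4.3.28] -/
theorem negSubspace_mono_nested (S : OffLineSplitN T ι) (S' : OffLineSplitN T' ι)
    (J : E →ₗ[ℝ] E') (hcomp : ∀ x : E, ⟪S.B x, x⟫_ℝ = ⟪S'.B (J x), J x⟫_ℝ)
    (hpull : ∀ i (x : E), ⟪S.v i, x⟫_ℝ = ⟪S'.v i, J x⟫_ℝ) {k : ℕ}
    (h : ∃ U : Submodule ℝ E, Module.finrank ℝ U = k ∧ ∀ x ∈ U, x ≠ 0 → ⟪T x, x⟫_ℝ < 0) :
    ∃ U' : Submodule ℝ E', Module.finrank ℝ U' = k ∧ ∀ y ∈ U', y ≠ 0 → ⟪T' y, y⟫_ℝ < 0 :=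
  negSubspace_map J (fun x => ⟪T x, x⟫_ℝ) (fun y => ⟪T' y, y⟫_ℝ)
    (inner_apply_self_nested S S' J hcomp hpull) (by simp) h

/-- The `EReal` capacitances are monotone along a nested pair for every coefficient vector,
`⨆ₓ (2∑cᵢ⟪vᵢ,x⟫ − ⟪Bx,x⟫) ≤ ⨆_y (2∑cᵢ⟪v'ᵢ,y⟫ − ⟪B'y,y⟫)` — gen 9's `capacitanceForm_mono` with
NO witness and NO positivity premise. [cite: HornJohnson2013, Cor. 7.7.4] -/
theorem iSup_trialN_mono_nested (S : OffLineSplitN T ι) (S' : OffLineSplitN T' ι)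
    (J : E →ₗ[ℝ] E') (hcomp : ∀ x : E, ⟪S.B x, x⟫_ℝ = ⟪S'.B (J x), J x⟫_ℝ)
    (hpull : ∀ i (x : E), ⟪S.v i, x⟫_ℝ = ⟪S'.v i, J x⟫_ℝ) (c : ι → ℝ) :
    ⨆ x : E, ((2 * ∑ i, c i * ⟪S.v i, x⟫_ℝ - ⟪S.B x, x⟫_ℝ : ℝ) : EReal) ≤
      ⨆ y : E', ((2 * ∑ i, c i * ⟪S'.v i, y⟫_ℝ - ⟪S'.B y, y⟫_ℝ : ℝ) : EReal) :=
  iSup_le fun x => by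
    have h : (2 * ∑ i, c i * ⟪S.v i, x⟫_ℝ - ⟪S.B x, x⟫_ℝ : ℝ) =
        2 * ∑ i, c i * ⟪S'.v i, J x⟫_ℝ - ⟪S'.B (J x), J x⟫_ℝ := by
      rw [hcomp]; congr 2; exact Finset.sum_congr rfl fun i _ => by rw [hpull]
    exact h ▸ le_iSup (fun y : E' => ((2 * ∑ i, c i * ⟪S'.v i, y⟫_ℝ - ⟪S'.B y, y⟫_ℝ : ℝ) :
      EReal)) (J x)

end InnerProduct

end Summit.RiemannHypothesis.RiemannHypothesis.Theorems.PfPersistenceIntruderCapacitanceVariational
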